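import Mathlib.Analysis.Complex.Schwarz
import Mathlib.Analysis.Complex.RemovableSingularity
import Summits.QuantumFields.YangMills.Theorems.BalabanUVNodesN21ResponseRadialTransversality

/-!
# N21 (NE7c) · THE CAUCHY RUNG: the quadratic-remainder letter `M` of the response rung from COMPLEX ANALYTICITY of the
# response on `r`-balls with oscillation `≤ B` — `M = 2B∕r²` (Schwarz lemma twice + removable singularity), realified to
# the block frame `κ → ℝ`, and part 34's `hRT` ∕ (M1) for ANALYTIC responses (W-SEAT START-LIST v3 §n21 item 3, rung 2)

Width seat `pub-ymgap-dag-n21-w3` (g0), node N21 = NE7c (single-run shell-weight bound, NOT PRINTED in [Bałaban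
1983–89], NOT proved), lane K3⁷ `SpineGivenEndpointR13SepCoPH` (stmt-QuantumFields-20544,
`--kind proof --supports … --as helper`).  Consumes BY NAME file 1 of this seat, `…N21ResponseRadialTransversality`
(`hRT_of_quadraticResponse`, `slotAntiConcentration_restrict_of_projectedCentre_quadraticResponse`), hence part 20
and part 34 of dag-n21-d's series; Mathlib's Schwarz lemma (`Complex.norm_dslope_le_div_of_mapsTo_ball`) and removable
singularity (`Complex.differentiableOn_dslope`).

WHY.  File 1 reduced part 34's radial-transversality binder `hRT` (lens N213 (α), «the N21 residual in one line») to a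
LINEARISATION WITH QUADRATIC REMAINDER of the block → plaquette-field response, `‖Φ w′ − Φ w − L_w(w′ − w)‖ ≤ M‖w′ − w‖²`,
plus the numeral `c₀ + 4MR² ≤ (1 − κ₀)θ(1−ρ)`.  In print the response (Bałaban's background ∕ minimiser as a function
of the field variables) is controlled by ANALYTICITY on complex neighbourhoods of fixed radius with bounded values
([B11] = CMP 102 (1985) 277–309, Theorem 1 p. 279: for data with field strength `|∂V − 1| < ε₁ ≤ a₁` — `a₁` a
THRESHOLD, not a radius — the minimiser satisfies `|U(∂p) − 1| < B₃ε₁·η²(L^jη)⁻²` (8); the ANALYTIC dependence on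
complex regular data is [RG1] = [B12] = CMP 109 (1987) 249, Lemma 4 p. 280 ∕ (1.15)–(1.16) p. 262: «analytic on the
above spaces», tree `Node00/CarriersB12*.analyticOn`; v1.1 precision after referee ref-O READ-17 NIT-1).  THIS FILE is the [textbook] bridge: complex
differentiability on `r`-balls about the real points with oscillation `≤ B` gives the quadratic remainder with
`M = 2B∕r²` and `L_w =` the (realified) Fréchet derivative — so the response rung's inputs become an analyticity
RADIUS and a VALUE BOUND, both of Theorem-1 type.  THE DEVICE IS PRINT'S OWN: [B12] (3.54) p. 280 bounds the
FIFTH-order Taylor remainder of `𝐄^{(j)}(X, U_j(□₀, exp i(τB + σB)))` along a complex ray by a Cauchy estimate from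
Lemma 4's analyticity and the sup bound (1.18) — typed in the tree as `B12CauchyRemainder354.ineq354` ∕
`norm_iteratedDeriv_le_of_ball` (lit-balaban r20); this file is the SECOND-order sibling in Schwarz form, pointed at
the response letters of part 34's `hRT` instead of at the effective action.

WHAT IS PROVED ([textbook]; 0 def, 0 sorry).
* §1 `norm_sub_sub_smul_deriv_le_of_mapsTo_ball` (one complex variable): `f` complex-differentiable on `ball c R₁`
  mapping it into `closedBall (f c) R₂` ⇒ `‖f z − f c − (z − c)•f′(c)‖ ≤ (2R₂∕R₁²)‖z − c‖²` on the ball (Schwarz for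
  `f`, then Schwarz for `dslope f c`, which is differentiable by the removable-singularity theorem).
* §2 `quadraticRemainder_of_differentiableOn_ball` (complex Banach frame `W`): `Φ` differentiable on `ball w r` with
  `Φ(ball w r) ⊆ closedBall (Φ w) B` ⇒ for `‖w′ − w‖ < r`: `‖Φ w′ − Φ w − DΦ(w)(w′ − w)‖ ≤ (2B∕r²)‖w′ − w‖²`
  (restrict to the complex line through `w, w′`).
* §3 `norm_realToComplex_pi`, `quadraticRemainder_pi_real_of_differentiableOn_ball`: the block frame `κ → ℝ ↪ κ → ℂ`
  (sup norms agree): for a real kept cut `K` of diameter `< r`, the realified response `x ↦ Φ(ι x)` admits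
  linearisations `L_x : (κ → ℝ) →ₗ[ℝ] E` with quadratic remainder `M = 2B∕r²` on `K` — EXACTLY file 1's hypothesis
  `hT` (as `∃ L, …`).
* §4 ★ `hRT_of_analyticResponse`: part 34's binder `hRT` in its exact shape for `U p = ⨆ q, ‖Φ q p.1 (ι p.2)‖`, from
  the analytic letters `(r, B)`, the kept-cut radius `R` about the centre (`2R < r`), the core reading `c₀` and the
  numeral `c₀ + 4(2B∕r²)R² ≤ (1 − κ₀)θ(1−ρ)`;  ★★ `slotAntiConcentration_restrict_of_projectedCentre_analyticResponse`:
  part 34's (M1) about the A-projected centre with `hRT` replaced by the analytic letters (LOCATED junction; other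
  binders displayed unchanged; A2: joint system not exhibited).
* §5 A2/A6 `analyticResponse_letters_inhabited`: the analytic letters of §2 are inhabited by a genuinely nonlinear
  entire function (`z ↦ z²` on `ball 0 1 ⊆ ℂ`, `R₁ = R₂ = 1`, constant `2R₂∕R₁² = 2`), and §1 fires on it.

DICTIONARY (NOT asserted; v1.1 precision): `r` = the analyticity radius in the block chart that Theorem 1's
threshold leaves (`ε₁ + c_B r ≤ a₁`, `c_B` = the chart's Lipschitz constant in plaquette readings; analyticity itself
from [RG1] Lemma 4), `B ↔` the oscillation of the plaquette readings on that ball (`≤ 2B₃(ε₁ + c_B r)·η²(L^jη)⁻²` by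
(8)), `R ↔` the block's small-field letter (`≤ ε₁`), `θ ↔ ε₀·η²(L^jη)⁻²`; the numeral then reads as Theorem 1's side
condition «`B₃ε₁ ≤ ε₀`» WITH A MARGIN — worked out in this seat's `…N21ResponseRungNumeralAtThm1Letters`
(`numeral_of_thm1Letters`: `B₃ε₁(1 + 16(1 + c_B)ε₁∕r) ≤ (1 − κ₀)(1 − ρ)ε₀`).  Reading `Φ` at NODE 00's `UbgOfRecord` and
certifying these letters at the record is NOT done here (NODE O's term object: the block chart).

HONEST FRAMING.  [textbook] complex analysis + normed-space algebra; located letters NOT asserted; nothing of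
Bałaban's asserted; NE7c NOT PRINTED ∕ NOT proved; N21 NOT discharged; counts unmoved (typed 28∕28 · discharged
5∕27); count-neutral; one finite 𝕋⁴ at fixed ε — YM mass gap (Clay) is NOT proved by any of this: R4 closes the
conditional finite-𝕋⁴ rung `BalabanLadder.UV` only; nothing continuum ∕ ℝ⁴ ∕ OS ∕ mass gap ∕ Clay.
-/

open MeasureTheory Set Function Matrix Metric
open scoped ENNReal

namespace Summit.QuantumFields.YangMills.Theorems.N21AnalyticResponseRemainder

open Literature.MathematicalPhysics.QuantumFieldTheory.Balaban1983to89.T4ShellMeasure (SlotAntiConcentration)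
open Summit.QuantumFields.YangMills.Theorems.N21ResponseRadialTransversality
  (hRT_of_quadraticResponse slotAntiConcentration_restrict_of_projectedCentre_quadraticResponse)

/-! ## §1  One complex variable: the second-order Taylor remainder from the Schwarz lemma applied twice -/

section OneVariable

variable {E : Type*} [NormedAddCommGroup E] [NormedSpace ℂ E] [CompleteSpace E]

/-- **SECOND-ORDER TAYLOR REMAINDER ON A DISC FROM A VALUE BOUND** (Cauchy-type estimate): if `f : ℂ → E` is complex
differentiable on `ball c R₁` and maps it into `closedBall (f c) R₂`, then for `z` in the ball
`‖f z − f c − (z − c) • deriv f c‖ ≤ (2R₂∕R₁²)·‖z − c‖²`.  Proof: Schwarz's lemma bounds `dslope f c` by `R₂∕R₁` on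
the ball; `dslope f c` is differentiable there (removable singularity), so Schwarz again bounds its own difference
quotient by `2R₂∕R₁²`. [textbook] -/
theorem norm_sub_sub_smul_deriv_le_of_mapsTo_ball {f : ℂ → E} {c z : ℂ} {R₁ R₂ : ℝ}
    (hd : DifferentiableOn ℂ f (ball c R₁)) (h_maps : MapsTo f (ball c R₁) (closedBall (f c) R₂))
    (hz : z ∈ ball c R₁) :
    ‖f z - f c - (z - c) • deriv f c‖ ≤ 2 * R₂ / R₁ ^ 2 * ‖z - c‖ ^ 2 := by
  have hR₁ : 0 < R₁ := lt_of_le_of_lt dist_nonneg (mem_ball.1 hz)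
  have hg : DifferentiableOn ℂ (dslope f c) (ball c R₁) :=
    (Complex.differentiableOn_dslope (ball_mem_nhds c hR₁)).2 hd
  have hgb : ∀ w ∈ ball c R₁, ‖dslope f c w‖ ≤ R₂ / R₁ := fun w hw =>
    Complex.norm_dslope_le_div_of_mapsTo_ball hd h_maps hw
  have hg_maps : MapsTo (dslope f c) (ball c R₁) (closedBall (dslope f c c) (2 * (R₂ / R₁))) := by
    intro w hw
    rw [mem_closedBall, dist_eq_norm]
    calc ‖dslope f c w - dslope f c c‖ ≤ ‖dslope f c w‖ + ‖dslope f c c‖ := norm_sub_le _ _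
      _ ≤ R₂ / R₁ + R₂ / R₁ := add_le_add (hgb w hw) (hgb c (mem_ball_self hR₁))
      _ = 2 * (R₂ / R₁) := by ring
  have h2 : ‖dslope (dslope f c) c z‖ ≤ 2 * (R₂ / R₁) / R₁ :=
    Complex.norm_dslope_le_div_of_mapsTo_ball hg hg_maps hz
  have hid : f z - f c - (z - c) • deriv f c = (z - c) • ((z - c) • dslope (dslope f c) c z) := by
    rw [sub_smul_dslope, smul_sub, sub_smul_dslope, dslope_same]
  rw [hid, norm_smul, norm_smul]
  have hzc : 0 ≤ ‖z - c‖ := norm_nonneg _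
  calc ‖z - c‖ * (‖z - c‖ * ‖dslope (dslope f c) c z‖)
      ≤ ‖z - c‖ * (‖z - c‖ * (2 * (R₂ / R₁) / R₁)) :=
        mul_le_mul_of_nonneg_left (mul_le_mul_of_nonneg_left h2 hzc) hzc
    _ = 2 * R₂ / R₁ ^ 2 * ‖z - c‖ ^ 2 := by
        field_simp

end OneVariable

/-! ## §2  Complex Banach frame: the quadratic remainder of a response differentiable on `r`-balls -/

section Banach

variable {W E : Type*} [NormedAddCommGroup W] [NormedSpace ℂ W] [NormedAddCommGroup E] [NormedSpace ℂ E]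
  [CompleteSpace E]

/-- **QUADRATIC REMAINDER FROM ANALYTICITY WITH A VALUE BOUND** (the Cauchy rung): if `Φ` is complex differentiable
on `ball w r` and maps it into `closedBall (Φ w) B`, then for every `w′` with `‖w′ − w‖ < r`:
`‖Φ w′ − Φ w − DΦ(w)(w′ − w)‖ ≤ (2B∕r²)‖w′ − w‖²` (§1 on the complex line `t ↦ w + t•(w′ − w)`). [textbook] -/
theorem quadraticRemainder_of_differentiableOn_ball (Φ : W → E) {w w' : W} {r B : ℝ}
    (hd : DifferentiableOn ℂ Φ (ball w r)) (hB : MapsTo Φ (ball w r) (closedBall (Φ w) B))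
    (hww' : ‖w' - w‖ < r) :
    ‖Φ w' - Φ w - (fderiv ℂ Φ w) (w' - w)‖ ≤ 2 * B / r ^ 2 * ‖w' - w‖ ^ 2 := by
  have hr : 0 < r := lt_of_le_of_lt (norm_nonneg _) hww'
  by_cases hu : w' - w = 0
  · have : w' = w := sub_eq_zero.1 hu
    subst this
    simp
  set u : W := w' - w with hu_def
  have hupos : 0 < ‖u‖ := norm_pos_iff.2 hu
  -- the complex line through w in direction u, and the restriction of Φ to it
  set ℓ : ℂ → W := fun t => w + t • u with hℓ
  set ρ₁ : ℝ := r / ‖u‖ with hρ₁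
  have hρ₁pos : 0 < ρ₁ := div_pos hr hupos
  have hℓball : MapsTo ℓ (ball (0 : ℂ) ρ₁) (ball w r) := by
    intro t ht
    rw [mem_ball, dist_eq_norm] at ht ⊢
    rw [sub_zero] at ht
    have : ℓ t - w = t • u := by rw [hℓ]; simp only; abel
    rw [this, norm_smul]
    calc ‖t‖ * ‖u‖ < ρ₁ * ‖u‖ := mul_lt_mul_of_pos_right ht hupos
      _ = r := by rw [hρ₁]; field_simp
  have hℓ0 : ℓ 0 = w := by rw [hℓ]; simp
  have hℓ1 : ℓ 1 = w' := by rw [hℓ]; simp only [one_smul]; rw [hu_def]; abel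
  have hℓdiff : Differentiable ℂ ℓ := (differentiable_id.smul_const u).const_add w
  have hfd : DifferentiableOn ℂ (Φ ∘ ℓ) (ball (0 : ℂ) ρ₁) := hd.comp hℓdiff.differentiableOn hℓball
  have hf_maps : MapsTo (Φ ∘ ℓ) (ball (0 : ℂ) ρ₁) (closedBall ((Φ ∘ ℓ) 0) B) := by
    intro t ht
    simp only [Function.comp_apply, hℓ0]
    exact hB (hℓball ht)
  have h1mem : (1 : ℂ) ∈ ball (0 : ℂ) ρ₁ := by
    rw [mem_ball, dist_zero_right, norm_one, hρ₁, lt_div_iff₀ hupos, one_mul]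
    exact hww'
  have hmain := norm_sub_sub_smul_deriv_le_of_mapsTo_ball hfd hf_maps h1mem
  -- the derivative of the restriction at 0 is DΦ(w) u
  have hΦw : HasFDerivAt Φ (fderiv ℂ Φ w) (ℓ 0) := by
    rw [hℓ0]
    exact ((hd w (mem_ball_self hr)).differentiableAt (ball_mem_nhds w hr)).hasFDerivAt
  have hℓ' : HasDerivAt ℓ ((1 : ℂ) • u) 0 := by
    rw [hℓ]
    exact ((hasDerivAt_id (0 : ℂ)).smul_const u).const_add w
  have hderiv : deriv (Φ ∘ ℓ) 0 = (fderiv ℂ Φ w) u := by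
    rw [(hΦw.comp_hasDerivAt (0 : ℂ) hℓ').deriv, one_smul]
  simp only [Function.comp_apply, hℓ0, hℓ1, sub_zero, one_smul, norm_one, one_pow, mul_one, hderiv] at hmain
  calc ‖Φ w' - Φ w - (fderiv ℂ Φ w) u‖ ≤ 2 * B / ρ₁ ^ 2 := hmain
    _ = 2 * B / r ^ 2 * ‖u‖ ^ 2 := by
        rw [hρ₁]
        field_simp

end Banach

/-! ## §3  The block frame `κ → ℝ ↪ κ → ℂ`: file 1's hypothesis `hT` from the analytic letters -/

section PiReal

variable {κ : Type*} [Fintype κ] {E : Type*} [NormedAddCommGroup E] [NormedSpace ℂ E] [CompleteSpace E]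

/-- the componentwise embedding `κ → ℝ ↪ κ → ℂ` preserves the sup norm. [textbook] -/
theorem norm_realToComplex_pi (x : κ → ℝ) : ‖(fun i => (x i : ℂ))‖ = ‖x‖ := by
  refine le_antisymm ((pi_norm_le_iff_of_nonneg (norm_nonneg x)).2 fun i => ?_)
    ((pi_norm_le_iff_of_nonneg (norm_nonneg _)).2 fun i => ?_)
  · rw [Complex.norm_real]; exact norm_le_pi_norm x i
  · rw [← Complex.norm_real]; exact norm_le_pi_norm (fun i => (x i : ℂ)) i

/-- **THE CAUCHY RUNG IN THE BLOCK FRAME** (file 1's `hT` from analyticity): if the complex response `Φ : (κ → ℂ) → E`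
is complex differentiable on the `r`-ball about every real point `ι x`, `x ∈ K`, with `Φ(ball) ⊆ closedBall (Φ(ι x)) B`,
and the real kept cut `K` has diameter `< r`, then the realified response `x ↦ Φ(ι x)` admits linearisations
`L_x : (κ → ℝ) →ₗ[ℝ] E` with `‖Φ(ι x′) − Φ(ι x) − L_x(x′ − x)‖ ≤ (2B∕r²)‖x′ − x‖²` for all `x, x′ ∈ K`
(`L_x =` the Fréchet derivative at `ι x`, restricted to real scalars and composed with `ι`). [textbook] -/
theorem quadraticRemainder_pi_real_of_differentiableOn_ball (Φ : (κ → ℂ) → E) {K : Set (κ → ℝ)} {r B : ℝ}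
    (hd : ∀ x ∈ K, DifferentiableOn ℂ Φ (ball (fun i => (x i : ℂ)) r))
    (hB : ∀ x ∈ K, MapsTo Φ (ball (fun i => (x i : ℂ)) r) (closedBall (Φ fun i => (x i : ℂ)) B))
    (hdiam : ∀ x ∈ K, ∀ x' ∈ K, ‖x' - x‖ < r) :
    ∃ L : (κ → ℝ) → (κ → ℝ) →ₗ[ℝ] E, ∀ x ∈ K, ∀ x' ∈ K,
      ‖Φ (fun i => (x' i : ℂ)) - Φ (fun i => (x i : ℂ)) - L x (x' - x)‖ ≤ 2 * B / r ^ 2 * ‖x' - x‖ ^ 2 := by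
  -- the real-linear embedding ι and the realified derivative
  let ι : (κ → ℝ) →ₗ[ℝ] (κ → ℂ) :=
    { toFun := fun x i => (x i : ℂ)
      map_add' := fun x y => by ext i; simp
      map_smul' := fun a x => by ext i; simp }
  refine ⟨fun x => ((fderiv ℂ Φ (ι x)).restrictScalars ℝ).toLinearMap.comp ι, fun x hx x' hx' => ?_⟩
  have hιsub : ι x' - ι x = ι (x' - x) := (map_sub ι x' x).symm
  have hnorm : ‖ι x' - ι x‖ = ‖x' - x‖ := by rw [hιsub]; exact norm_realToComplex_pi (x' - x)
  have hlt : ‖ι x' - ι x‖ < r := by rw [hnorm]; exact hdiam x hx x' hx'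
  have hd' : DifferentiableOn ℂ Φ (ball (ι x) r) := hd x hx
  have hB' : MapsTo Φ (ball (ι x) r) (closedBall (Φ (ι x)) B) := hB x hx
  have h := quadraticRemainder_of_differentiableOn_ball Φ hd' hB' hlt
  rw [hnorm, hιsub] at h
  exact h

end PiReal

/-! ## §4  Part 34's `hRT` and (M1) for ANALYTIC responses -/

section Junction

variable {X : Type*} {κ : Type*} [Fintype κ] {E : Type*} [NormedAddCommGroup E] [NormedSpace ℂ E]
  [CompleteSpace E] {P : Type*} [Fintype P] [Nonempty P]

/-- ★ **PART 34's RADIAL-TRANSVERSALITY BINDER `hRT` FOR AN ANALYTIC RESPONSE** (file 1 `hRT_of_quadraticResponse`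
with `hT` supplied by the Cauchy rung §3): tested variable `U p = ⨆ q, ‖Φ q p.1 (ι p.2)‖`; letters: analyticity radius
`r` and oscillation `B` of every plaquette response about every real point of the kept cut, kept cut in the ball of
radius `R` about the centre with `2R < r`, core reading `c₀`, numeral `c₀ + 4(2B∕r²)R² ≤ (1 − κ₀)θ(1−ρ)`, and a cut
`C ⊆ {p | p.2 ∈ K p.1}`. [textbook] -/
theorem hRT_of_analyticResponse (Φ : P → X → (κ → ℂ) → E) (K : X → Set (κ → ℝ)) (c : X → (κ → ℝ))
    {r B R c₀ θ ρ κ₀ : ℝ} (hB0 : 0 ≤ B)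
    (hd : ∀ q z, ∀ x ∈ K z, DifferentiableOn ℂ (Φ q z) (ball (fun i => (x i : ℂ)) r))
    (hB : ∀ q z, ∀ x ∈ K z, MapsTo (Φ q z) (ball (fun i => (x i : ℂ)) r) (closedBall (Φ q z fun i => (x i : ℂ)) B))
    (hcK : ∀ z, c z ∈ K z) (hKR : ∀ z, ∀ w ∈ K z, ‖w - c z‖ ≤ R) (hRr : 2 * R < r)
    (hc₀ : ∀ q z, ‖Φ q z (fun i => (c z i : ℂ))‖ ≤ c₀)
    {C : Set (X × (κ → ℝ))} (hCK : ∀ p ∈ C, p.2 ∈ K p.1)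
    (hnum : c₀ + 4 * (2 * B / r ^ 2) * R ^ 2 ≤ (1 - κ₀) * (θ * (1 - ρ))) :
    ∀ p : X × (κ → ℝ), θ * (1 - ρ) ≤ (⨆ q, ‖Φ q p.1 (fun i => (p.2 i : ℂ))‖) →
      (⨆ q, ‖Φ q p.1 (fun i => (p.2 i : ℂ))‖) < θ → p ∈ C → ∀ s : ℝ, 1 ≤ s →
      θ * (1 - ρ) ≤ (⨆ q, ‖Φ q p.1 (fun i => ((c p.1 + s • (p.2 - c p.1)) i : ℂ))‖) →
        (⨆ q, ‖Φ q p.1 (fun i => ((c p.1 + s • (p.2 - c p.1)) i : ℂ))‖) < θ →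
          (p.1, c p.1 + s • (p.2 - c p.1)) ∈ C →
          (⨆ q, ‖Φ q p.1 (fun i => (p.2 i : ℂ))‖) + κ₀ * (θ * (1 - ρ)) * (s - 1)
            ≤ ⨆ q, ‖Φ q p.1 (fun i => ((c p.1 + s • (p.2 - c p.1)) i : ℂ))‖ := by
  -- diameter of the kept cut
  have hdiam : ∀ z, ∀ x ∈ K z, ∀ x' ∈ K z, ‖x' - x‖ < r := by
    intro z x hx x' hx'
    calc ‖x' - x‖ = ‖(x' - c z) - (x - c z)‖ := by congr 1; abel
      _ ≤ ‖x' - c z‖ + ‖x - c z‖ := norm_sub_le _ _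
      _ ≤ R + R := add_le_add (hKR z x' hx') (hKR z x hx)
      _ < r := by linarith
  -- the Cauchy rung, plaquette by plaquette and exterior configuration by exterior configuration
  have hT : ∀ q z, ∃ L : (κ → ℝ) → (κ → ℝ) →ₗ[ℝ] E, ∀ x ∈ K z, ∀ x' ∈ K z,
      ‖Φ q z (fun i => (x' i : ℂ)) - Φ q z (fun i => (x i : ℂ)) - L x (x' - x)‖
        ≤ 2 * B / r ^ 2 * ‖x' - x‖ ^ 2 :=
    fun q z => quadraticRemainder_pi_real_of_differentiableOn_ball (Φ q z) (hd q z) (hB q z) (hdiam z)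
  choose L hL using hT
  have hM : 0 ≤ 2 * B / r ^ 2 := by positivity
  exact hRT_of_quadraticResponse (fun q z x => Φ q z fun i => (x i : ℂ)) L K c hM
    (fun q z x hx x' hx' => hL q z x hx x' hx') hcK hKR (fun q z => hc₀ q z) hCK hnum

/-- ★★ **(M1) ON THE CUT LAW ABOUT THE A-PROJECTED CENTRE FOR AN ANALYTIC RESPONSE** (file 1
`slotAntiConcentration_restrict_of_projectedCentre_quadraticResponse`, hence part 34, with the quadratic-remainder
letter SUPPLIED by the Cauchy rung: `M = 2B∕r²`).  LOCATED junction: part 34's remaining binders displayed unchanged;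
A2: the joint system is not exhibited here. [textbook] -/
theorem slotAntiConcentration_restrict_of_projectedCentre_analyticResponse [MeasurableSpace X] [Nonempty κ]
    (ζ : Measure X) [SFinite ζ]
    (K : X → Set (κ → ℝ)) (A : Matrix κ κ ℝ) (hA : A.IsSymm) {γ G : ℝ} (hγ0 : 0 < γ)
    (hγ : ∀ x : κ → ℝ, γ * ‖x‖ ^ 2 ≤ x ⬝ᵥ (A *ᵥ x))
    (m : X → (κ → ℝ)) {c : X → (κ → ℝ)} (hc : Measurable c) (Pz : X → (κ → ℝ) → ℝ)
    (hg : Measurable fun p : X × (κ → ℝ) => (K p.1).indicator (fun w => ENNReal.ofReal (Real.exp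
      (-(1 / 2 * ((w - m p.1) ⬝ᵥ (A *ᵥ (w - m p.1))) + Pz p.1 w)))) p.2)
    (Φ : P → X → (κ → ℂ) → E) {r B R c₀ : ℝ} (hB0 : 0 ≤ B)
    (hd : ∀ q z, ∀ x ∈ K z, DifferentiableOn ℂ (Φ q z) (ball (fun i => (x i : ℂ)) r))
    (hB : ∀ q z, ∀ x ∈ K z, MapsTo (Φ q z) (ball (fun i => (x i : ℂ)) r) (closedBall (Φ q z fun i => (x i : ℂ)) B))
    (hKR : ∀ z, ∀ w ∈ K z, ‖w - c z‖ ≤ R) (hRr : 2 * R < r)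
    (hc₀ : ∀ q z, ‖Φ q z (fun i => (c z i : ℂ))‖ ≤ c₀)
    (hUm : Measurable fun p : X × (κ → ℝ) => ⨆ q, ‖Φ q p.1 (fun i => (p.2 i : ℂ))‖)
    {C Env : Set (X × (κ → ℝ))} (hC : MeasurableSet C) (hEnv : MeasurableSet Env)
    (hCK : ∀ p ∈ C, p.2 ∈ K p.1)
    {θ ρ κ₀ Q : ℝ} (hθ : 0 < θ) (hρ0 : 0 < ρ) (hρ1 : ρ < 1) (hκ : 0 < κ₀) (hQ0 : 0 ≤ Q)
    (hnum : c₀ + 4 * (2 * B / r ^ 2) * R ^ 2 ≤ (1 - κ₀) * (θ * (1 - ρ)))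
    (hK : ∀ z, Convex ℝ (K z)) (hcK : ∀ z, c z ∈ K z)
    (hP : ∀ z, ∀ v ∈ K z, ∀ v' ∈ K z, Pz z v - Pz z v' ≤ G * ‖v - v'‖)
    (hobt : ∀ p : X × (κ → ℝ), θ * (1 - ρ) ≤ (⨆ q, ‖Φ q p.1 (fun i => (p.2 i : ℂ))‖) →
      (⨆ q, ‖Φ q p.1 (fun i => (p.2 i : ℂ))‖) < θ → p ∈ C →
      p.2 ∈ K p.1 → 0 ≤ (c p.1 - m p.1) ⬝ᵥ (A *ᵥ (p.2 - c p.1)))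
    (hfar : ∀ p : X × (κ → ℝ), θ * (1 - ρ) ≤ (⨆ q, ‖Φ q p.1 (fun i => (p.2 i : ℂ))‖) →
      (⨆ q, ‖Φ q p.1 (fun i => (p.2 i : ℂ))‖) < θ → p ∈ C →
      p.2 ∈ K p.1 → 2 * G ≤ γ * ‖p.2 - c p.1‖)
    (henv : ∀ l ∈ Icc (1 - 1 / ((Fintype.card κ : ℝ) + 1)) 1, ∀ p : X × (κ → ℝ),
      θ * (1 - ρ) ≤ (⨆ q, ‖Φ q p.1 (fun i => (p.2 i : ℂ))‖) →
        (⨆ q, ‖Φ q p.1 (fun i => (p.2 i : ℂ))‖) < θ → p ∈ C →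
        (p.1, c p.1 + l • (p.2 - c p.1)) ∈ Env)
    (hQ : ((ζ.prod volume).withDensity fun p : X × (κ → ℝ) => (K p.1).indicator (fun w => ENNReal.ofReal (Real.exp
        (-(1 / 2 * ((w - m p.1) ⬝ᵥ (A *ᵥ (w - m p.1))) + Pz p.1 w)))) p.2)
        (Env \ ({p | (⨆ q, ‖Φ q p.1 (fun i => (p.2 i : ℂ))‖) < θ} ∩ C))
      ≤ ENNReal.ofReal Q * ((ζ.prod volume).withDensity fun p : X × (κ → ℝ) => (K p.1).indicator (fun w =>
        ENNReal.ofReal (Real.exp (-(1 / 2 * ((w - m p.1) ⬝ᵥ (A *ᵥ (w - m p.1))) + Pz p.1 w)))) p.2)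
        ({p | (⨆ q, ‖Φ q p.1 (fun i => (p.2 i : ℂ))‖) < θ} ∩ C)) :
    SlotAntiConcentration
      ((((ζ.prod volume).withDensity fun p : X × (κ → ℝ) => (K p.1).indicator (fun w => ENNReal.ofReal (Real.exp
          (-(1 / 2 * ((w - m p.1) ⬝ᵥ (A *ᵥ (w - m p.1))) + Pz p.1 w)))) p.2)).restrict
        ({p | (⨆ q, ‖Φ q p.1 (fun i => (p.2 i : ℂ))‖) < θ} ∩ C))
      (fun p : X × (κ → ℝ) => ⨆ q, ‖Φ q p.1 (fun i => (p.2 i : ℂ))‖) θ ρ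
      (3 * ((Fintype.card κ : ℝ) + 1) * (1 + Q) / (κ₀ * (1 - ρ))) := by
  have hdiam : ∀ z, ∀ x ∈ K z, ∀ x' ∈ K z, ‖x' - x‖ < r := by
    intro z x hx x' hx'
    calc ‖x' - x‖ = ‖(x' - c z) - (x - c z)‖ := by congr 1; abel
      _ ≤ ‖x' - c z‖ + ‖x - c z‖ := norm_sub_le _ _
      _ ≤ R + R := add_le_add (hKR z x' hx') (hKR z x hx)
      _ < r := by linarith
  have hT : ∀ q z, ∃ L : (κ → ℝ) → (κ → ℝ) →ₗ[ℝ] E, ∀ x ∈ K z, ∀ x' ∈ K z,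
      ‖Φ q z (fun i => (x' i : ℂ)) - Φ q z (fun i => (x i : ℂ)) - L x (x' - x)‖
        ≤ 2 * B / r ^ 2 * ‖x' - x‖ ^ 2 :=
    fun q z => quadraticRemainder_pi_real_of_differentiableOn_ball (Φ q z) (hd q z) (hB q z) (hdiam z)
  choose L hL using hT
  have hM : 0 ≤ 2 * B / r ^ 2 := by positivity
  exact slotAntiConcentration_restrict_of_projectedCentre_quadraticResponse ζ K A hA hγ0 hγ m hc Pz hg
    (fun q z x => Φ q z fun i => (x i : ℂ)) L hM (fun q z x hx x' hx' => hL q z x hx x' hx') hKR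
    (fun q z => hc₀ q z) hUm hC hEnv hCK hθ hρ0 hρ1 hκ hQ0 hnum hK hcK hP hobt hfar henv hQ

end Junction

/-! ## §5  A2/A6: the analytic letters are inhabited by a nonlinear entire function, and §1 fires on it -/

/-- **A2/A6 — THE ANALYTIC LETTERS OF §1–§2 ARE INHABITED BY A GENUINELY NONLINEAR RESPONSE**: `z ↦ z²` is complex
differentiable on `ball 0 1 ⊆ ℂ` and maps it into `closedBall 0 1` (`R₁ = R₂ = 1`), it is not affine, and §1's
conclusion holds for it (here with the displayed constant `2R₂∕R₁² = 2`). [textbook] -/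
theorem analyticResponse_letters_inhabited :
    DifferentiableOn ℂ (fun z : ℂ => z ^ 2) (ball 0 1) ∧
    MapsTo (fun z : ℂ => z ^ 2) (ball 0 1) (closedBall ((fun z : ℂ => z ^ 2) 0) 1) ∧
    (¬ ∃ a b : ℂ, ∀ z : ℂ, z ^ 2 = a * z + b) ∧
    ∀ z ∈ ball (0 : ℂ) 1, ‖(fun z : ℂ => z ^ 2) z - (fun z : ℂ => z ^ 2) 0 - (z - 0) • deriv (fun z : ℂ => z ^ 2) 0‖
      ≤ 2 * 1 / 1 ^ 2 * ‖z - 0‖ ^ 2 := by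
  have hd : DifferentiableOn ℂ (fun z : ℂ => z ^ 2) (ball 0 1) := (differentiable_pow 2).differentiableOn
  have hmaps : MapsTo (fun z : ℂ => z ^ 2) (ball 0 1) (closedBall ((fun z : ℂ => z ^ 2) 0) 1) := by
    intro z hz
    rw [mem_ball, dist_zero_right] at hz
    simp only [mem_closedBall, dist_eq_norm, ne_eq, OfNat.ofNat_ne_zero, not_false_eq_true, zero_pow, sub_zero,
      norm_pow]
    nlinarith [norm_nonneg z]
  refine ⟨hd, hmaps, ?_, fun z hz => norm_sub_sub_smul_deriv_le_of_mapsTo_ball hd hmaps hz⟩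
  rintro ⟨a, b, h⟩
  have h0 := h 0
  have h1 := h 1
  have h2 := h 2
  have htwo : (2 : ℂ) = 0 := by linear_combination h2 - 2 * h1 + h0
  norm_num at htwo

end Summit.QuantumFields.YangMills.Theorems.N21AnalyticResponseRemainder
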